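import Mathlib
import HarnessLib
import Summits.HubbardSuperconductivity.HubbardSuperconductivity.Theorems.KLProgrammeKLRegimeEngineIsoBoxNearFar
import Summits.HubbardSuperconductivity.HubbardSuperconductivity.Theorems.KLProgrammeKLRegimeIsoSectorMultiplierFat

/-!
# Route `KLProgramme` — ENGINE item stmt-HubbardSuperconductivity-20437, class #6 / (E5-F)ₙ producer, route (M): the BARE momentum kernel on a scale-`m` box from the
# multiplied kernels `T` of the PARENT iso tuples one scale up (the plateau `Σ_ω F̄_{m−1,ω} ≡ 1` on `{ρ ≤ Λ_m}`) — the entry for the same-spin patterns (M4 (i) via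
# p1b's `norm_kernel_klEffectiveAction_four_le_two_mul`, which reads the kernel on a product set)

Cell gate-hubbard-kl, seat hubbard-kl-k3c2-p2 (g11; owner-designate of M1 + M3 of route (M), pen (R59az)).  The `T`-sup chain (…EngineNearSupFromValue / …EngineIsoBoxNearFar) controls
`T_Ω = (∏_i F̄_{m,ω_i})·K` on the support box of `Ω`, not the bare kernel `K`; p1b g12's pattern lemma `norm_kernel_klEffectiveAction_four_le_two_mul` (p571792: every
spin/charge pattern `≤ 2×` the standard `(+↑,−↑,+↓,−↓)` pattern on a product set `A⁴`) wants the BARE standard-pattern kernel on `A⁴`.  The bridge is the partition of unity one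
scale up: the iso multipliers of resolution `m−1` sum to the cutoff `C_{m−1}⁻¹(ρ)` (`sum_klIsoMultiplier`, `sum_bgmMultiplier`), which is `≡ 1` on `ρ ≤ Λ_m` (`gnScaleCutoff_eq_one`) ⊇ the
scale-`m` boxes; so `K(X) = Σ_{parent tuples Ω′} T^{(m−1)}_{Ω′}(X)` with at most `3` parents per leg (`card_filter_sectorWeightCirc_ne_zero_le`):

* §1 (generic) `kernel_eq_sum_prodKernel_of_sum_eq_one`, **`norm_kernel_le_card_pow_mul_of_sum_eq_one`** — if `Σ_ω F′_ω(k_i) = 1` on every leg and `|(∏_i F′_{w_i}(k_i))·K(X)| ≤ S` for every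
  sector string `w` inside the supports, then `‖K(X)‖ ≤ (∏_i #{ω : F′_ω(k_i) ≠ 0})·S`;
* §2 (iso) `sum_klIsoFamily_eq_one_of_le` (`Σ_ω F̄_{m′,ω}(k) = 1` if `ρ_K(k) ≤ Λ_{m′+1}`), `card_filter_klIsoFamily_ne_zero_le_three`,
  **`norm_kernel_klEffectiveAction_le_parents_supT`** — for a string `X` with `ρ_K(k_i) ≤ Λ_{m′+1}` on every leg: `‖K_n(X)‖ ≤ 3^4·S` whenever the parent `T^{(m′)}`'s are `≤ S`.

With `supT_klIso_le_of_value_moments` at resolution `m′ = m − 1` (standard pattern) this gives the bare standard-pattern kernel on (box_m ∪ reference points)⁴, hence every pattern by p1b's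
factor `2` — the same-spin iso tuples of (E5-F)ₙ.  Everything is proved; no definitions; nothing about the model is asserted.
References: BGM 2006 §2.3 (2.19), §2.5 (2.45), (2.57) [cite: BenfattoGiulianiMastropietro2006].
-/

noncomputable section

namespace Summit.HubbardSuperconductivity.HubbardSuperconductivity.Theorems.EngineV8

set_option linter.dupNamespace false -- summit = problem name (single-conjunct summit), D-0017

open Classical
open Real Finset Complex Literature.MathematicalPhysics.QuantumLattice Literature.Probability.LatticeModels GrassmannAlgebra
open Summit.HubbardSuperconductivity.HubbardSuperconductivity.Theorems.KLProgrammeLegKernels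
open Summit.HubbardSuperconductivity.HubbardSuperconductivity.Theorems.KLRegimeSplit
open scoped ComplexConjugate

open Summit.HubbardSuperconductivity.HubbardSuperconductivity.Theorems.PerturbedFermiCurve (support_klIsoFamily card_filter_sectorWeightCirc_ne_zero_le)
open Summit.HubbardSuperconductivity.HubbardSuperconductivity.Theorems.TorusFourierL2 (klIsoFamily_eq_zero_of_le)

variable {L M : ℕ} [NeZero L]

/-! ## §1 A kernel from its multiplied copies under a partition of unity -/

section Generic

omit [NeZero L] in
/-- **`K(X) = Σ_w (∏_i F′_{w_i}(k_i))·K(X)`** when the family `F′` sums to `1` at every leg's momentum (`∏_i (Σ_ω F′_ω(k_i)) = 1`, expanded). -/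
theorem kernel_eq_sum_prodKernel_of_sum_eq_one {N' m : ℕ} (F' : Fin N' → FreqMomentum L M → ℂ) (G : HubbardGrassmann L M)
    (X : Fin m → HubbardFieldIdx L M) (hsum : ∀ i, ∑ ω, F' ω (X i).1.1 = 1) :
    kernel ℂ G m X = ∑ w : Fin m → Fin N', (∏ i, F' (w i) (X i).1.1) * kernel ℂ G m X := by
  rw [← sum_mul, ← Fintype.prod_sum (fun i ω => F' ω (X i).1.1), prod_eq_one (fun i _ => hsum i), one_mul]

omit [NeZero L] in
/-- **`‖K(X)‖ ≤ (∏_i #{ω : F′_ω(k_i) ≠ 0})·S`** when `F′` sums to `1` on every leg and the multiplied kernels are `≤ S` for every sector string inside the supports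
(off the supports the multiplied kernel vanishes). -/
theorem norm_kernel_le_card_pow_mul_of_sum_eq_one {N' m : ℕ} (F' : Fin N' → FreqMomentum L M → ℂ) (G : HubbardGrassmann L M)
    (X : Fin m → HubbardFieldIdx L M) (hsum : ∀ i, ∑ ω, F' ω (X i).1.1 = 1) {S : ℝ}
    (hS : ∀ w : Fin m → Fin N', (∀ i, F' (w i) (X i).1.1 ≠ 0) → ‖(∏ i, F' (w i) (X i).1.1) * kernel ℂ G m X‖ ≤ S) :
    ‖kernel ℂ G m X‖ ≤ (∏ i : Fin m, ((((univ : Finset (Fin N')).filter fun ω => F' ω (X i).1.1 ≠ 0).card : ℕ) : ℝ)) * S := by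
  rw [kernel_eq_sum_prodKernel_of_sum_eq_one F' G X hsum]
  -- the strings inside the supports
  set P : Finset (Fin m → Fin N') := Fintype.piFinset fun i => (univ : Finset (Fin N')).filter fun ω => F' ω (X i).1.1 ≠ 0 with hP
  have hPcard : (P.card : ℝ) = ∏ i : Fin m, ((((univ : Finset (Fin N')).filter fun ω => F' ω (X i).1.1 ≠ 0).card : ℕ) : ℝ) := by
    rw [hP, Fintype.card_piFinset]; push_cast; rfl
  have hvan : ∀ w ∈ (univ : Finset (Fin m → Fin N')), w ∉ P → (∏ i, F' (w i) (X i).1.1) * kernel ℂ G m X = 0 := by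
    intro w _ hw
    have hj : ∃ j, F' (w j) (X j).1.1 = 0 := by
      by_contra h
      push Not at h
      exact hw (Fintype.mem_piFinset.2 fun j => mem_filter.2 ⟨mem_univ _, h j⟩)
    obtain ⟨j, hj⟩ := hj
    rw [prod_eq_zero (mem_univ j) hj, zero_mul]
  rw [← sum_subset (subset_univ P) hvan]
  refine (norm_sum_le _ _).trans ?_
  calc ∑ w ∈ P, ‖(∏ i, F' (w i) (X i).1.1) * kernel ℂ G m X‖ ≤ ∑ _w ∈ P, S :=
        sum_le_sum fun w hw => hS w fun i => (mem_filter.1 (Fintype.mem_piFinset.1 hw i)).2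
    _ = P.card * S := by rw [sum_const, nsmul_eq_mul]
    _ = _ := by rw [hPcard]

end Generic

/-! ## §2 The iso plateau one scale up -/

section Iso

variable [NeZero M]

omit [NeZero L] [NeZero M] in
/-- **The iso multipliers of resolution `m′` sum to `1` wherever `ρ_K ≤ Λ_{m′+1}`** (angular partition of unity × the cutoff plateau `C_{−m′}⁻¹ ≡ 1` on `ρ ≤ e₀ 4^{−m′−1}`). -/
theorem sum_klIsoFamily_eq_one_of_le (β μ : ℝ) (K : TrigPolyC4v) (m' : ℕ) (k : FreqMomentum L M)
    (hk : Real.sqrt (matsubaraFreq β M k.1 ^ 2 + nambuXiCT L μ K k.2 ^ 2) ≤ klScale klE0 (m' + 1)) :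
    ∑ ω, klIsoFamily L M β μ K klE0 m' ω k = 1 := by
  have he : (0 : ℝ) < klE0 := by norm_num [klE0]
  rw [klIsoFamily, sum_klIsoMultiplier, sum_bgmMultiplier, gnScaleCutoff_eq_one (by norm_num) he, Complex.ofReal_one]
  refine hk.trans (le_of_eq ?_)
  rw [klScale, show (-(m' : ℤ) - 1) = -((m' + 1 : ℕ) : ℤ) by push_cast; ring, zpow_neg, zpow_natCast]

omit [NeZero L] [NeZero M] in
/-- **At most three iso multipliers of one resolution are nonzero at a given momentum** (three smooth angular sectors see a direction). -/
theorem card_filter_klIsoFamily_ne_zero_le_three (β μ : ℝ) (K : TrigPolyC4v) (m' : ℕ) (k : FreqMomentum L M) :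
    ((univ : Finset (Fin (sectorCount (2 * m')))).filter fun ω => klIsoFamily L M β μ K klE0 m' ω k ≠ 0).card ≤ 3 := by
  have he : (0 : ℝ) < klE0 := by norm_num [klE0]
  refine le_trans (card_le_card fun ω hω => ?_) (card_filter_sectorWeightCirc_ne_zero_le (2 * m') (momentumAngle L k.2))
  rw [mem_filter] at hω ⊢
  exact ⟨mem_univ _, by simpa using (support_klIsoFamily L M he β μ K m' ω k hω.2).2.2⟩

omit [NeZero M] in
/-- **THE BARE KERNEL OF `𝒱ₙ[K]` FROM THE PARENT MULTIPLIED KERNELS**: for a label string `X` whose legs all satisfy `ρ_K(k_i) ≤ Λ_{m′+1}` (e.g. legs in scale-`(m′+1)` iso boxes, or the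
(E5-F) reference points at such scales), if `‖(∏_i F̄_{m′,w_i}(k_i))·K_n(X)‖ ≤ S` for every parent sector string `w` inside the supports, then `‖K_n(X)‖ ≤ 3^q·S` (`q` legs). -/
theorem norm_kernel_klEffectiveAction_le_parents_supT (β U μ : ℝ) (K : TrigPolyC4v) (n m' : ℕ) {q : ℕ} (X : Fin q → HubbardFieldIdx L M)
    (hX : ∀ i, Real.sqrt (matsubaraFreq β M (X i).1.1.1 ^ 2 + nambuXiCT L μ K (X i).1.1.2 ^ 2) ≤ klScale klE0 (m' + 1)) {S : ℝ} (hS0 : 0 ≤ S)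
    (hS : ∀ w : Fin q → Fin (sectorCount (2 * m')), (∀ i, klIsoFamily L M β μ K klE0 m' (w i) (X i).1.1 ≠ 0) →
      ‖(∏ i, klIsoFamily L M β μ K klE0 m' (w i) (X i).1.1) * kernel ℂ (klEffectiveAction L M β U μ K klE0 n) q X‖ ≤ S) :
    ‖kernel ℂ (klEffectiveAction L M β U μ K klE0 n) q X‖ ≤ (3 : ℝ) ^ q * S := by
  have h := norm_kernel_le_card_pow_mul_of_sum_eq_one (klIsoFamily L M β μ K klE0 m') (klEffectiveAction L M β U μ K klE0 n) X
    (fun i => sum_klIsoFamily_eq_one_of_le β μ K m' (X i).1.1 (hX i)) hS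
  refine h.trans (mul_le_mul_of_nonneg_right ?_ hS0)
  calc (∏ i : Fin q, ((((univ : Finset (Fin (sectorCount (2 * m')))).filter fun ω => klIsoFamily L M β μ K klE0 m' ω (X i).1.1 ≠ 0).card : ℕ) : ℝ))
      ≤ ∏ _i : Fin q, (3 : ℝ) := prod_le_prod (fun i _ => Nat.cast_nonneg _) fun i _ => by
          exact_mod_cast card_filter_klIsoFamily_ne_zero_le_three β μ K m' (X i).1.1
    _ = (3 : ℝ) ^ q := by rw [prod_const, card_univ, Fintype.card_fin]

end Iso

end Summit.HubbardSuperconductivity.HubbardSuperconductivity.Theorems.EngineV8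

end
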